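/-
Origin: expansion seat `prover-pub-hodgecm-mc-binder-1-g16-0`, handover #R105 2026-08-20T20:01:13Z md5 b42adf61b669 (314 l.; NEW additive universe-free leaf; imports HodgeCM.Model.ToyG2.LevelExists only; drops ⇒ {#R106, #R108}; NAME LIST: HodgeCM.Model.LocalMinkowski.valuation_natCast_le_one · HodgeCM.Model.LocalMinkowski.valuation_natCast_eq_one_of_prime_ne_three · HodgeCM.Model.LocalMinkowski.valued_pow_apply_le · HodgeCM.Model.LocalMinkowski.valuation_apply_le_sq_of_one_add_pow · HodgeCM.Model.LocalMinkowski.valuation_apply_le_pow_of_one_add_pow · HodgeCM.Model.LocalMinkowski.eq_zero_of_forall_le_pow · HodgeCM.Model.LocalMinkowski.eq_one_of_mem_valuedCongruenceSubgroup_three · HodgeCM.Model.LocalMinkowski.exists_place_three_mem · HodgeCM.Model.LocalMinkowski.valued_three_lt_one · HodgeCM.Model.LocalMinkowski.idealRadius_span_singleton · HodgeCM.Model.LocalMinkowski.idealRadius_span_three · HodgeCM.Model.LocalMinkowski.generalLinearGroup_map_adicCompletion_injective) (`HOME/mc/pub-hodgecm-mc-binder-1-g16/stage62/HodgeCM/Model/LocalMinkowski.lean`,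 md5 b42adf61b669, 314 lines);
landed by the second packager p2 gen 13 (p2-g13) in gate run 62 as `HodgeCM/Model/LocalMinkowski.lean` (verbatim).
-/
/-
Copyright (c) 2026 the pub-hodgecm formalisation cell (harness21).  New file, not vendored.
Origin: session prover-pub-hodgecm-mc-binder-1-g16-0 (unit pub-hodgecm-mc-binder-1-g16, BINDER PROVER gen 16 of lineage mc-binder-1;
content lane (J-Liu-Θ), (J3) design memo `HOME/mc/pub-hodgecm-mc-axioms-1-g15/J3-DESIGN.md` §3, HECKE-TOWER sub-leaf (T0)
«conjugate levels», number-theoretic half: the local Minkowski lemma), 2026-08-20.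
-/
import Summits.HodgeConjecture.HodgeCM.Model.ToyG2.LevelExists

/-!
# Local Minkowski: finite-order elements of `1 + 3·M_m(𝒪_w)` are trivial

The number theory behind the torsion-freeness of the CONJUGATE levels `U(V)(L₀) ∩ h K_f(3) h⁻¹`
(`HodgeCM/Model/LevelConjugate.lean`), done at ONE finite place instead of through the lattice
`L³ ∩ h 𝒪̂³` (which is not free over `𝓞_L` in general):

* `eq_one_of_mem_valuedCongruenceSubgroup_three` — over a valued field `(F, v)` of characteristic `0`
  with value group `ℤₘ₀` and `v 3 < 1` (residue characteristic `3`), an element of `GL_m(F)` of finite order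
  in the valued congruence subgroup of radius `v 3` (vendored `valuedCongruenceSubgroup`: `g, g⁻¹` integral,
  `v((g - 1)_{ij}) ≤ v 3`) is trivial.  Proof (Minkowski 1887 / Serre): reduce to prime order `p`; binomial
  expansion of `(1 + N)^p = 1` and the ultrametric inequality improve `v(N_{ij}) ≤ t` to `v(N_{ij}) ≤ t²`
  as long as `t^{p-2} ≤ v p` (`valuation_apply_le_sq_of_one_add_pow`; for `p ≠ 3`, `v p = 1` by
  `valuation_natCast_eq_one_of_prime_ne_three`; for `p = 3` this is where the radius `v 3` — not `1` — is
  needed), hence `v(N_{ij}) ≤ (v 3)^k` for all `k` (`valuation_apply_le_pow_of_one_add_pow`), hence `N = 0`.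
* `exists_place_three_mem`, `valued_three_lt_one`, `idealRadius_span_singleton` / `idealRadius_span_three`
  (`|(3)|_w = |3|_w`, bridging the vendored `idealRadius` of `UnitaryGroup.finCongruenceLevel` to `Valued.v`),
  `generalLinearGroup_map_adicCompletion_injective` — the number-field glue used at a place `w ∣ 3` of `L`.

Mathlib (`Valued`, `HeightOneSpectrum.adicCompletion`, `WithZero.log`) and the vendored `GLnAdelicStructure`
API only; the companion global statement for the STANDARD lattice is `ToyG2.eq_one_of_isCongruentOneMod_three`
(`Model/ToyG2/LevelExists.lean`), which this file does not use.
-/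

noncomputable section

open scoped Matrix MatrixGroups
open NumberField IsDedekindDomain
open Literature.NumberTheory.Automorphic

namespace HodgeCM.Model.LocalMinkowski

/-! ## 1. Local Minkowski: finite-order elements of `1 + 3·M_m(𝒪)` are trivial -/

section LocalMinkowski

variable {F : Type*} [Field F] {Γ₀ : Type*} [LinearOrderedCommGroupWithZero Γ₀] [Valued F Γ₀]
variable {m : Type*} [Fintype m] [DecidableEq m]

/-- `v n ≤ 1` for a natural number `n` (non-archimedean triangle inequality). -/
theorem valuation_natCast_le_one (n : ℕ) : Valued.v (n : F) ≤ 1 := by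
  induction n with
  | zero => simp
  | succ n ih =>
    rw [Nat.cast_succ]
    exact Valued.v.map_add_le ih (le_of_eq Valued.v.map_one)

/-- If `v 3 < 1` then `v p = 1` for every prime `p ≠ 3` (`p` and `3` are coprime: `a p + 3 b = 1`). -/
theorem valuation_natCast_eq_one_of_prime_ne_three (hv3 : Valued.v (3 : F) < 1) {p : ℕ} (hp : p.Prime)
    (hp3 : p ≠ 3) : Valued.v (p : F) = 1 := by
  refine le_antisymm (valuation_natCast_le_one p) ?_
  by_contra hlt
  rw [not_le] at hlt
  have hcop : IsCoprime (p : ℤ) (3 : ℤ) := by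
    have h1 : Nat.Coprime p 3 := (Nat.coprime_primes hp Nat.prime_three).mpr hp3
    exact_mod_cast Nat.isCoprime_iff_coprime.mpr h1
  obtain ⟨a, b, hab⟩ := hcop
  have hab' : (a : F) * (p : F) + (b : F) * (3 : F) = 1 := by exact_mod_cast congrArg (Int.cast : ℤ → F) hab
  have hva : Valued.v (a : F) ≤ 1 := by
    obtain ⟨n, rfl | rfl⟩ := Int.eq_nat_or_neg a
    · exact_mod_cast valuation_natCast_le_one (F := F) n
    · rw [Int.cast_neg, Int.cast_natCast, Valuation.map_neg]; exact valuation_natCast_le_one n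
  have hvb : Valued.v (b : F) ≤ 1 := by
    obtain ⟨n, rfl | rfl⟩ := Int.eq_nat_or_neg b
    · exact_mod_cast valuation_natCast_le_one (F := F) n
    · rw [Int.cast_neg, Int.cast_natCast, Valuation.map_neg]; exact valuation_natCast_le_one n
  have h1 : Valued.v ((a : F) * (p : F) + (b : F) * (3 : F)) < 1 := by
    refine Valued.v.map_add_lt ?_ ?_
    · rw [Valuation.map_mul]
      calc Valued.v (a : F) * Valued.v (p : F) ≤ 1 * Valued.v (p : F) := mul_le_mul' hva le_rfl
        _ < 1 := by rwa [one_mul]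
    · rw [Valuation.map_mul]
      calc Valued.v (b : F) * Valued.v (3 : F) ≤ 1 * Valued.v (3 : F) := mul_le_mul' hvb le_rfl
        _ < 1 := by rwa [one_mul]
  rw [hab', Valuation.map_one] at h1
  exact lt_irrefl _ h1

/-- Ultrametric bound for the entries of a power: `v((N^k)_{ij}) ≤ t^k` if `v(N_{ij}) ≤ t`. -/
theorem valued_pow_apply_le {N : Matrix m m F} {t : Γ₀} (hN : ∀ i j, Valued.v (N i j) ≤ t) :
    ∀ (k : ℕ) (i j : m), Valued.v ((N ^ k) i j) ≤ t ^ k := by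
  intro k
  induction k with
  | zero =>
    intro i j
    rw [pow_zero, pow_zero, Matrix.one_apply]
    split_ifs <;> simp
  | succ k ih =>
    intro i j
    rw [pow_succ, pow_succ]
    exact valued_mul_apply_le m ih hN i j

/-- **The induction step of the local Minkowski lemma.** If `(1 + N)^p = 1` for a prime `p = q + 2` with
`v p ≠ 0`, all entries of `N` have valuation `≤ t ≤ 1` and `t ^ q ≤ v p`, then all entries of `N` have
valuation `≤ t²`: from `p N = -Σ_{i ≥ 2} C(p,i) N^i` and `p ∣ C(p,i)` (`2 ≤ i < p`) every term on the right has
valuation `≤ v(p) t²`. -/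
theorem valuation_apply_le_sq_of_one_add_pow {N : Matrix m m F} {q : ℕ} (hp : (q + 2).Prime)
    (hp0 : Valued.v ((q + 2 : ℕ) : F) ≠ 0) {t : Γ₀} (ht1 : t ≤ 1) (htp : t ^ q ≤ Valued.v ((q + 2 : ℕ) : F))
    (hN : ∀ i j, Valued.v (N i j) ≤ t) (h : (1 + N) ^ (q + 2) = 1) (i j : m) :
    Valued.v (N i j) ≤ t ^ 2 := by
  classical
  -- binomial expansion, peeled at the orders `0` and `1`
  have hcomm : Commute N (1 : Matrix m m F) := Commute.one_right N
  have hexp := hcomm.add_pow' (q + 2)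
  rw [Finset.Nat.sum_antidiagonal_eq_sum_range_succ
    (fun a b => (q + 2).choose a • (N ^ a * (1 : Matrix m m F) ^ b)) (q + 2)] at hexp
  simp only [one_pow, mul_one, Nat.succ_eq_add_one] at hexp
  rw [add_comm N 1, h, Finset.sum_range_succ', Finset.sum_range_succ'] at hexp
  have hij := congrArg (fun M : Matrix m m F => M i j) hexp
  simp only [Matrix.add_apply, Matrix.sum_apply, Matrix.smul_apply, pow_zero,
    Nat.choose_zero_right, one_smul, zero_add, pow_one, Nat.choose_one_right] at hij
  -- hij : 1 i j = (∑ k < q+1, C(q+2,k+2) • (N^(k+2)) i j) + (q+2) • N i j + 1 i j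
  have h0 : (∑ k ∈ Finset.range (q + 1),
      (q + 2).choose (k + 1 + 1) • (N ^ (k + 1 + 1)) i j) + (q + 2) • N i j = 0 :=
    add_right_cancel (hij.symm.trans (zero_add _).symm)
  have hsum : Valued.v (∑ k ∈ Finset.range (q + 1),
      (q + 2).choose (k + 1 + 1) • (N ^ (k + 1 + 1)) i j) ≤ Valued.v ((q + 2 : ℕ) : F) * t ^ 2 := by
    refine Valued.v.map_sum_le fun k hk => ?_
    have hk' : k < q + 1 := Finset.mem_range.mp hk
    have hpow : Valued.v ((N ^ (k + 1 + 1)) i j) ≤ t ^ (k + 2) := valued_pow_apply_le hN (k + 2) i j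
    rw [nsmul_eq_mul, Valuation.map_mul]
    rcases Nat.lt_or_ge (k + 2) (q + 2) with hlt | hge
    · -- `p ∣ C(p, k+2)` for `0 < k+2 < p`
      obtain ⟨c, hc⟩ : (q + 2) ∣ (q + 2).choose (k + 2) := hp.dvd_choose_self (by omega) hlt
      have h12 : k + 1 + 1 = k + 2 := rfl
      rw [h12, hc, Nat.cast_mul, Valuation.map_mul]
      have hle2 : t ^ (k + 2) ≤ t ^ 2 := pow_le_pow_right_of_le_one' ht1 (by omega)
      calc Valued.v ((q + 2 : ℕ) : F) * Valued.v (c : F) * Valued.v ((N ^ (k + 2)) i j)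
          ≤ Valued.v ((q + 2 : ℕ) : F) * 1 * t ^ 2 :=
            mul_le_mul' (mul_le_mul' le_rfl (valuation_natCast_le_one c)) (hpow.trans hle2)
        _ = Valued.v ((q + 2 : ℕ) : F) * t ^ 2 := by rw [mul_one]
    · have hkq : k = q := by omega
      subst hkq
      have h12 : k + 1 + 1 = k + 2 := rfl
      rw [h12, Nat.choose_self, Nat.cast_one, Valuation.map_one, one_mul]
      calc Valued.v ((N ^ (k + 2)) i j) ≤ t ^ (k + 2) := hpow
        _ = t ^ k * t ^ 2 := pow_add t k 2
        _ ≤ Valued.v ((k + 2 : ℕ) : F) * t ^ 2 := mul_le_mul' htp le_rfl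
  have hpN : Valued.v ((q + 2 : ℕ) : F) * Valued.v (N i j) ≤ Valued.v ((q + 2 : ℕ) : F) * t ^ 2 := by
    have hneg : (q + 2) • N i j = -(∑ k ∈ Finset.range (q + 1),
        (q + 2).choose (k + 1 + 1) • (N ^ (k + 1 + 1)) i j) := eq_neg_of_add_eq_zero_right h0
    have hv : Valued.v ((q + 2 : ℕ) : F) * Valued.v (N i j) = Valued.v ((q + 2) • N i j) := by
      rw [nsmul_eq_mul, Valuation.map_mul]
    rw [hv, hneg, Valuation.map_neg]
    exact hsum
  calc Valued.v (N i j) = (Valued.v ((q + 2 : ℕ) : F))⁻¹ * (Valued.v ((q + 2 : ℕ) : F) * Valued.v (N i j)) := by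
        rw [← mul_assoc, inv_mul_cancel₀ hp0, one_mul]
    _ ≤ (Valued.v ((q + 2 : ℕ) : F))⁻¹ * (Valued.v ((q + 2 : ℕ) : F) * t ^ 2) := mul_le_mul' le_rfl hpN
    _ = t ^ 2 := by rw [← mul_assoc, inv_mul_cancel₀ hp0, one_mul]

/-- **Local Minkowski, matrix form.** Over a valued field of characteristic zero with `v 3 < 1`: if
`(1 + N)^p = 1` for a prime `p` and `v(N_{ij}) ≤ v 3` for all `i, j`, then `v(N_{ij}) ≤ (v 3)^(k+1)` for
every `k`. -/
theorem valuation_apply_le_pow_of_one_add_pow [CharZero F] (hv3 : Valued.v (3 : F) < 1)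
    {N : Matrix m m F} {p : ℕ} (hp : p.Prime) (hN : ∀ i j, Valued.v (N i j) ≤ Valued.v (3 : F))
    (h : (1 + N) ^ p = 1) (k : ℕ) : ∀ i j, Valued.v (N i j) ≤ Valued.v (3 : F) ^ (k + 1) := by
  obtain ⟨q, rfl⟩ : ∃ q, p = q + 2 := ⟨p - 2, (Nat.sub_add_cancel hp.two_le).symm⟩
  have hp0 : Valued.v ((q + 2 : ℕ) : F) ≠ 0 :=
    (Valuation.ne_zero_iff _).mpr (by exact_mod_cast hp.ne_zero)
  have hv31 : Valued.v (3 : F) ≤ 1 := hv3.le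
  induction k with
  | zero => simpa only [zero_add, pow_one] using hN
  | succ k ih =>
    intro i j
    -- apply the step with `t = v(3)^(k+1)`
    have ht1 : Valued.v (3 : F) ^ (k + 1) ≤ 1 := pow_le_one' hv31 _
    have htp : (Valued.v (3 : F) ^ (k + 1)) ^ q ≤ Valued.v ((q + 2 : ℕ) : F) := by
      by_cases hq : q + 2 = 3
      · have hq1 : q = 1 := by omega
        subst hq1
        have h3 : ((1 + 2 : ℕ) : F) = 3 := by norm_num
        rw [pow_one, h3]
        calc Valued.v (3 : F) ^ (k + 1) = Valued.v (3 : F) ^ k * Valued.v (3 : F) := pow_succ _ _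
          _ ≤ 1 * Valued.v (3 : F) := mul_le_mul' (pow_le_one' hv31 _) le_rfl
          _ = Valued.v (3 : F) := one_mul _
      · rw [valuation_natCast_eq_one_of_prime_ne_three hv3 hp hq]
        exact pow_le_one' ht1 _
    have hstep := valuation_apply_le_sq_of_one_add_pow hp hp0 ht1 htp ih h i j
    calc Valued.v (N i j) ≤ (Valued.v (3 : F) ^ (k + 1)) ^ 2 := hstep
      _ = Valued.v (3 : F) ^ (2 * k + 2) := by rw [← pow_mul]; ring_nf
      _ ≤ Valued.v (3 : F) ^ (k + 1 + 1) := pow_le_pow_right_of_le_one' hv31 (by omega)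

end LocalMinkowski

section LocalMinkowskiZm0

variable {F : Type*} [Field F] [Valued F (WithZero (Multiplicative ℤ))] [CharZero F]
variable {m : Type*} [Fintype m] [DecidableEq m]

/-- In `ℤₘ₀`: if `x ≤ c ^ (k+1)` for every `k`, with `c < 1`, then `x = 0`. -/
theorem eq_zero_of_forall_le_pow {x c : (WithZero (Multiplicative ℤ))} (hc : c < 1) (h : ∀ k : ℕ, x ≤ c ^ (k + 1)) : x = 0 := by
  by_contra hx
  by_cases hc0 : c = 0
  · subst hc0
    have := h 0
    rw [zero_add, pow_one, le_zero_iff] at this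
    exact hx this
  -- logarithms: `log x ≤ (k+1) • log c ≤ -(k+1)` for all `k`
  have hlc : WithZero.log c ≤ -1 := by
    have : WithZero.log c < WithZero.log 1 := (WithZero.log_lt_log hc0 one_ne_zero).mpr hc
    rw [WithZero.log_one] at this
    omega
  have hk := h (WithZero.log x).natAbs
  have hck0 : c ^ ((WithZero.log x).natAbs + 1) ≠ 0 := pow_ne_zero _ hc0
  rw [← WithZero.log_le_log hx hck0, WithZero.log_pow] at hk
  have : ((WithZero.log x).natAbs + 1 : ℕ) • WithZero.log c ≤ ((WithZero.log x).natAbs + 1 : ℕ) • (-1 : ℤ) :=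
    nsmul_le_nsmul_right hlc _
  rw [smul_neg, nsmul_one] at this
  have hfin := hk.trans this
  omega

/-- **Local Minkowski lemma** (Minkowski 1887, Serre): over a valued field `(F, v)` of characteristic zero
with values in `ℤₘ₀` and `v 3 < 1` (residue characteristic `3`), an element of `GL_m(F)` of finite order
lying in the valued congruence subgroup of radius `v 3` — `g, g⁻¹` integral and `v((g - 1)_{ij}) ≤ v 3` —
is trivial. -/
theorem eq_one_of_mem_valuedCongruenceSubgroup_three (hv3 : Valued.v (3 : F) < 1) (g : GL m F)
    (hg : g ∈ valuedCongruenceSubgroup m (Valued.v (3 : F))) (hfin : IsOfFinOrder g) : g = 1 := by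
  classical
  by_contra hne
  have hk0 : orderOf g ≠ 0 := (hfin.orderOf_pos).ne'
  have hk1 : orderOf g ≠ 1 := by rwa [Ne, orderOf_eq_one_iff]
  -- a prime divisor `p` of the order; `h := g ^ (ord / p)` has order `p`
  set p := (orderOf g).minFac with hpdef
  have hp : p.Prime := Nat.minFac_prime hk1
  have hpd : p ∣ orderOf g := Nat.minFac_dvd _
  set h := g ^ (orderOf g / p) with hh
  have hord : orderOf h = p := orderOf_pow_orderOf_div hk0 hpd
  have hhp : h ^ p = 1 := by rw [← hord]; exact pow_orderOf_eq_one h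
  have hh3 : h ∈ valuedCongruenceSubgroup m (Valued.v (3 : F)) := Subgroup.pow_mem _ hg _
  -- `h = 1 + N` with `v(N_{ij}) ≤ v 3`
  set N : Matrix m m F := (h : Matrix m m F) - 1 with hNdef
  have hN : ∀ i j, Valued.v (N i j) ≤ Valued.v (3 : F) := (mem_valuedCongruenceSubgroup_iff.mp hh3).2.2
  have h1N : (1 + N) ^ p = 1 := by
    rw [hNdef, add_sub_cancel, ← Units.val_pow_eq_pow_val, hhp, Units.val_one]
  have hN0 : N = 0 := by
    ext i j
    rw [Matrix.zero_apply, ← (Valued.v : Valuation F (WithZero (Multiplicative ℤ))).zero_iff]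
    exact eq_zero_of_forall_le_pow hv3 fun k => valuation_apply_le_pow_of_one_add_pow hv3 hp hN h1N k i j
  have h1 : h = 1 := by
    apply Units.ext
    have : (h : Matrix m m F) = 1 + N := by rw [hNdef, add_sub_cancel]
    rw [this, hN0, add_zero, Units.val_one]
  rw [h1, orderOf_one] at hord
  exact hp.one_lt.ne hord

end LocalMinkowskiZm0

/-! ## 2. A place of `L` above `3`; the radius `|3|_w` -/

section Place

variable (L : Type) [Field L] [NumberField L]

/-- There is a finite place `w` of `L` dividing `3` (`3` is not a unit of `𝓞 L`). -/
theorem exists_place_three_mem : ∃ w : HeightOneSpectrum (𝓞 L), (3 : 𝓞 L) ∈ w.asIdeal := by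
  have h3top : Ideal.span {(3 : 𝓞 L)} ≠ ⊤ := by
    rw [Ne, Ideal.span_singleton_eq_top]; exact ToyG2.not_isUnit_three L
  obtain ⟨𝔭, h𝔭max, h3𝔭⟩ := Ideal.exists_le_maximal _ h3top
  have h𝔭0 : 𝔭 ≠ ⊥ := by
    intro hbot
    have := h3𝔭 (Ideal.mem_span_singleton_self _)
    rw [hbot, Ideal.mem_bot] at this
    norm_num at this
  exact ⟨⟨𝔭, h𝔭max.isPrime, h𝔭0⟩, h3𝔭 (Ideal.mem_span_singleton_self _)⟩

variable {L}

/-- At a place `w ∣ 3`: `|3|_w < 1` in `L_w`. -/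
theorem valued_three_lt_one {w : HeightOneSpectrum (𝓞 L)} (hw : (3 : 𝓞 L) ∈ w.asIdeal) :
    Valued.v (3 : w.adicCompletion L) < 1 := by
  have e1 : ((3 : 𝓞 L) : L) = 3 := map_ofNat (algebraMap (𝓞 L) L) 3
  have h3 : (3 : w.adicCompletion L) = (((3 : 𝓞 L) : L) : w.adicCompletion L) := by
    rw [e1]; exact (map_ofNat (algebraMap L (w.adicCompletion L)) 3).symm
  rw [h3, HeightOneSpectrum.valuedAdicCompletion_eq_valuation', HeightOneSpectrum.valuation_of_algebraMap]
  exact (w.intValuation_lt_one_iff_mem _).mpr hw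

/-- The radius of the principal ideal `(r)` at `w` is `|r|_w` (`FractionalIdeal.count_coe`,
`intValuation_if_neg`). -/
theorem idealRadius_span_singleton (w : HeightOneSpectrum (𝓞 L)) {r : 𝓞 L} (hr : r ≠ 0) :
    idealRadius L w (Ideal.span {r}) = Valued.v ((r : L) : w.adicCompletion L) := by
  have hJ : (Ideal.span {r} : Ideal (𝓞 L)) ≠ 0 := by
    rw [Ne, Ideal.zero_eq_bot, Ideal.span_singleton_eq_bot]; exact hr
  rw [idealRadius, FractionalIdeal.count_coe L w hJ, HeightOneSpectrum.valuedAdicCompletion_eq_valuation',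
    HeightOneSpectrum.valuation_of_algebraMap, w.intValuation_if_neg hr]

/-- `|(3)|_w = |3|_w`. -/
theorem idealRadius_span_three (w : HeightOneSpectrum (𝓞 L)) :
    idealRadius L w (Ideal.span {((3 : ℕ) : 𝓞 L)}) = Valued.v (3 : w.adicCompletion L) := by
  have h3 : ((3 : ℕ) : 𝓞 L) ≠ 0 := by norm_num
  rw [idealRadius_span_singleton w h3]
  have e1 : (((3 : ℕ) : 𝓞 L) : L) = 3 := by rw [Nat.cast_ofNat]; exact map_ofNat (algebraMap (𝓞 L) L) 3
  rw [e1]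
  exact congrArg _ (map_ofNat (algebraMap L (w.adicCompletion L)) 3)

/-- `GL_m(L) → GL_m(L_w)` is injective. -/
theorem generalLinearGroup_map_adicCompletion_injective (w : HeightOneSpectrum (𝓞 L)) {n : Type*}
    [Fintype n] [DecidableEq n] :
    Function.Injective (Matrix.GeneralLinearGroup.map (n := n) (algebraMap L (w.adicCompletion L))) := by
  intro g g' hgg'
  apply Units.ext
  exact Matrix.map_injective (algebraMap L (w.adicCompletion L)).injective (congrArg Units.val hgg')

end Place

end HodgeCM.Model.LocalMinkowski

end
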